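import Summits.Ventures.HodgeRepro2.T5UnimodularWeights

/-!
# Matrix coefficients on a stable line: `|⟪w, π g w⟫| = ‖w‖²`

Blind cell `pub-hodge-repro2`, seat p1 (gen 12), Tier-5 kernel support for the S4 row P3
(«j = 1: |⟨π₀(g)f, f⟩|² = ‖f‖⁴ on U(2)» — `π₀` a one-dimensional representation): the POINTWISE form.
`T5CompactFactor` / `T5SchurOrthogonality.integral_norm_sq_matrixCoefficient_of_finrank_eq_one` gave the
integrated form `∫ ‖⟪v, π g u⟫‖² dμ = ‖u‖²‖v‖²`; here, on a stable line spanned by `w ≠ 0` in a continuous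
representation of a compact group, `π g w = weight g • w` with `‖weight g‖ = 1`
(`T5UnimodularWeights.norm_weight_eq_one`), so

* `inner_apply_eq_weight_mul` — `⟪w, π g w⟫ = weight g · ‖w‖²`;
* **`norm_inner_apply_eq`** — `‖⟪w, π g w⟫‖ = ‖w‖²`, hence `‖⟪w, π g w⟫‖² = ‖w‖⁴`
  (`norm_inner_apply_sq_eq`);
* **`norm_inner_apply_eq_of_finrank_eq_one`** — for a ONE-dimensional `V`, `‖⟪f, π g f⟫‖ = ‖f‖²`
  for every `f` (the row P3 shape).

No unitarity for the given inner product is assumed.  Honest scope (unchanged): compact groups,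
finite-dimensional representations; that `π₀` at `τ′₁` is the character `det^m` of U(2) stays [C].
-/

namespace Summit.Ventures.HodgeRepro2.T5LineCoefficient

open MeasureTheory T5SchurOrthogonality T5CompleteReducibility T5AbelianWeights T5UnimodularWeights

variable {G : Type*} [Group G] [TopologicalSpace G] [IsTopologicalGroup G]
  [MeasurableSpace G] [BorelSpace G] [CompactSpace G]
variable {V : Type*} [NormedAddCommGroup V] [InnerProductSpace ℂ V]
variable (μ : Measure G) [IsProbabilityMeasure μ] [μ.IsOpenPosMeasure] [μ.IsMulLeftInvariant]
variable (π : G →* V →L[ℂ] V) (hπ : Continuous π)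
variable {W : Submodule ℂ V} (hW : IsStable π W) (h1 : Module.finrank ℂ W = 1)
variable {w : V} (hw : w ∈ W) (hw0 : w ≠ 0)

omit [TopologicalSpace G] [IsTopologicalGroup G] [MeasurableSpace G] [BorelSpace G] [CompactSpace G]
  [IsProbabilityMeasure μ] [μ.IsOpenPosMeasure] [μ.IsMulLeftInvariant] in
/-- `⟪w, π g w⟫ = weight g · ‖w‖²` on a stable line. -/
theorem inner_apply_eq_weight_mul (g : G) :
    inner ℂ w (π g w) = weight π hW h1 hw hw0 g * (‖w‖ : ℂ) ^ 2 := by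
  rw [weight_spec π hW h1 hw hw0 g, inner_smul_right, inner_self_eq_norm_sq_to_K]
  rfl

include μ hπ hW h1 hw hw0 in
/-- **`‖⟪w, π g w⟫‖ = ‖w‖²`** on a stable line of a continuous representation of a compact group. -/
theorem norm_inner_apply_eq (g : G) : ‖inner ℂ w (π g w)‖ = ‖w‖ ^ 2 := by
  rw [inner_apply_eq_weight_mul π hW h1 hw hw0 g, norm_mul, norm_weight_eq_one μ π hπ hW h1 hw hw0 g,
    one_mul, norm_pow, Complex.norm_real, Real.norm_eq_abs, abs_norm]

include μ hπ hW h1 hw hw0 in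
/-- `‖⟪w, π g w⟫‖² = ‖w‖⁴` (the row P3 shape on a line). -/
theorem norm_inner_apply_sq_eq (g : G) : ‖inner ℂ w (π g w)‖ ^ 2 = ‖w‖ ^ 4 := by
  rw [norm_inner_apply_eq μ π hπ hW h1 hw hw0 g]
  ring

omit hW h1 hw hw0 in
include μ hπ in
/-- **One-dimensional representations**: if `dim V = 1`, then `‖⟪f, π g f⟫‖ = ‖f‖²` for every `f`
(row P3: `|⟨π₀(g)f, f⟩|² = ‖f‖⁴`). -/
theorem norm_inner_apply_eq_of_finrank_eq_one (hV : Module.finrank ℂ V = 1) (f : V) (g : G) :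
    ‖inner ℂ f (π g f)‖ = ‖f‖ ^ 2 := by
  by_cases hf : f = 0
  · subst hf
    simp
  · have htop : Module.finrank ℂ (⊤ : Submodule ℂ V) = 1 := by rw [finrank_top, hV]
    exact norm_inner_apply_eq μ π hπ (isStable_top π) htop (Submodule.mem_top (x := f)) hf g

end Summit.Ventures.HodgeRepro2.T5LineCoefficient
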